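import Summits.AtomisticToContinuum.FouriersLaw.Theorems.PhononMeanFreePathIncoherentChannelCommonPastBoundHelper2

/-!
# `stub_commonPastBound` — the fixed-`N` dictionary of the line `two-horizons-forecast-loss`

Stub 3 of the skeleton of crux `PhononMeanFreePath.IncoherentChannel` (stmt-AtomisticToContinuum-11811,
line `two-horizons-forecast-loss`), over the route vocabulary of `PhononMeanFreePathDefs`: the
`(N+1)`-site pinned anharmonic chain `pinnedChain ω₂ lam β γ` with both Langevin baths at `T > 0`,
`μ_T = gibbsMeasure (N+1) T`, `K_t = transitionKernel (N+1) T T t⁺`, mean forecast `v_t = K_t p_N`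
(`fcast`), forecast norm `S_N(t) = ‖v_t‖²_{L²(μ_T)}` (`fnorm`), pair correlation
`r_N(t) = ⟨p_0, v_t⟩_{μ_T}` (`pairCorr`) and common-past part `P_N(t) = Cov_{μ_T}(p_0², v_t²)`
(`commonPast`). The stub slaves the mean-forecast quantities to `S_N`:

1. `t ↦ P_N(t)` and `t ↦ r_N(t)` are measurable (helper 2: joint measurability of `(t,z) ↦ v_t(z)` +
   Fubini measurability);
2. `r_N(t)² ≤ T·S_N(t)` (helper 2: Cauchy–Schwarz, `‖p_0‖² = T`);
3. for every `θ ∈ (0,1)` an `N`-INDEPENDENT constant `K(θ,T)` with `|P_N(t)| ≤ K·S_N(t)^θ` for all `N`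
   and `t` — proved here: `P_N = ∫ (p_0² − T) v_t² dμ_T`; Hölder with exponents `(2k, q)`,
   `q = 2k/(2k−1)`, against the Gaussian moment `∫ |p_0² − T|^{2k} dμ_T ≤ D_k(T)` (helper 1, a
   constant in `(k,T)` only — the `p_0`-marginal of `μ_T` is `N(0,T)` for every `N`); then the
   `L²–L⁴` interpolation `∫ |v_t|^{2q} ≤ (∫ v_t²)^{2−q} (∫ v_t⁴)^{q−1}` (Hölder again) with
   `∫ v_t⁴ dμ_T ≤ 3T²` and `S_N ≤ T` (helper 2: kernel Jensen + Gibbs invariance of `K_t`), and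
   `(2−q)/q = 1 − 1/k ≥ θ` once `k ≥ 1/(1−θ)`. The constant is
   `K = (3T²·D_k(T))^{1/(2k)} · T^{1−1/k−θ}`.

No transport content; true at every coupling including the harmonic corner.
-/

noncomputable section

namespace Summit.AtomisticToContinuum.FouriersLaw.Theorems.PhononMeanFreePath

open MeasureTheory Set Filter Topology ProbabilityTheory
open scoped NNReal ENNReal
open Literature.MathematicalPhysics.KineticTheory.HeatConduction

/-! ### Hölder and `L²–L⁴` interpolation: `|P_N(t)| ≤ K(θ,T)·S_N(t)^θ` -/

/-- `f ∈ L^p` from integrability of `|f|^p` (real exponent `p > 0`). [folklore] -/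
theorem commonPastBound_memLp_of_integrable_abs_rpow {α : Type*} [MeasurableSpace α] {μ : Measure α}
    {f : α → ℝ} {p : ℝ} (hp : 0 < p) (hf : AEStronglyMeasurable f μ)
    (hint : Integrable (fun x => |f x| ^ p) μ) : MemLp f (ENNReal.ofReal p) μ := by
  refine (integrable_norm_rpow_iff hf (by simp [hp]) (by simp)).1 ?_
  rw [ENNReal.toReal_ofReal hp.le]
  simpa only [Real.norm_eq_abs] using hint

section Holder

variable {ω₂ lam β γ T : ℝ} (hω : 0 < ω₂) (hl : 0 ≤ lam) (hβ : 0 ≤ β) (hγ : 0 ≤ γ) (hT : 0 < T)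
include hω hl hβ hγ hT

/-- **The interpolation bound with an explicit `N`-independent constant.** For an integer `k ≥ 2`
and `θ ≤ 1 − 1/k`: `|P_N(t)| ≤ (D_k(T)·3T²)^{1/(2k)} · T^{1−1/k−θ} · S_N(t)^θ` for all `N`, `t`,
where `D_k(T) = 2^{2k}((4k−1)!!·T^{2k} + T^{2k}) ≥ ∫ |p_0² − T|^{2k} dμ_T`. Proof:
`P_N = ∫ (p_0² − T) v_t² dμ_T`; Hölder with exponents `(2k, q)`, `q = 2k/(2k−1)`; then
`∫ |v_t|^{2q} ≤ (∫ v_t²)^{2−q} (∫ v_t⁴)^{q−1}` (Hölder again), `∫ v_t⁴ ≤ 3T²`, `S_N ≤ T`, and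
`(2−q)/q = 1 − 1/k ≥ θ`. [folklore] -/
theorem commonPastBound_abs_commonPast_le_of_two_le {k : ℕ} (hk : 2 ≤ k) {θ : ℝ}
    (hθk : θ ≤ 1 - 1 / (k : ℝ)) (N : ℕ) (t : ℝ) :
    |commonPast ω₂ lam β γ T N t| ≤
      ((2 ^ (2 * k) * (T ^ (2 * k) * ∏ j ∈ Finset.range (2 * k), (2 * (j : ℝ) + 1) + T ^ (2 * k))) ^
          (1 / (2 * (k : ℝ))) * (3 * T ^ 2) ^ (1 / (2 * (k : ℝ))) * T ^ (1 - 1 / (k : ℝ) - θ)) *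
        fnorm ω₂ lam β γ T N t ^ θ := by
  haveI : IsProbabilityMeasure ((pinnedChain ω₂ lam β γ).gibbsMeasure (N + 1) T) :=
    pinnedChain_isProbabilityMeasure_gibbsMeasure hω hl hβ γ (N + 1) hT
  set μ₀ := (pinnedChain ω₂ lam β γ).gibbsMeasure (N + 1) T with hμ₀
  set v : PhaseSpace (N + 1) → ℝ := fun z => fcast ω₂ lam β γ T N t z with hv
  set D : ℝ := 2 ^ (2 * k) * (T ^ (2 * k) * ∏ j ∈ Finset.range (2 * k), (2 * (j : ℝ) + 1) +
    T ^ (2 * k)) with hD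
  -- the exponents `p = 2k`, `q = p' = 2k/(2k-1)`, `a = 2 - q`, `b = q - 1`
  set κ : ℝ := (k : ℝ) with hκ
  have hκ2 : (2 : ℝ) ≤ κ := by rw [hκ]; exact_mod_cast hk
  have hκne : κ ≠ 0 := by positivity
  have h2κ1 : 0 < 2 * κ - 1 := by linarith
  have hne : 2 * κ - 1 ≠ 0 := h2κ1.ne'
  have h2κne : 2 * κ ≠ 0 := by positivity
  obtain ⟨p, hp⟩ : ∃ p : ℝ, p = 2 * κ := ⟨_, rfl⟩
  obtain ⟨q, hq⟩ : ∃ q : ℝ, q = 2 * κ / (2 * κ - 1) := ⟨_, rfl⟩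
  obtain ⟨a, ha⟩ : ∃ a : ℝ, a = (2 * κ - 2) / (2 * κ - 1) := ⟨_, rfl⟩
  obtain ⟨b, hb⟩ : ∃ b : ℝ, b = 1 / (2 * κ - 1) := ⟨_, rfl⟩
  have hp0 : 0 < p := by rw [hp]; positivity
  have hq0 : 0 < q := by rw [hq]; positivity
  have ha0 : 0 < a := by rw [ha]; exact div_pos (by linarith) h2κ1
  have hb0 : 0 < b := by rw [hb]; exact div_pos one_pos h2κ1
  have hpq : p.HolderConjugate q := by
    refine ⟨?_, hp0, hq0⟩
    rw [inv_one, hp, hq, inv_div, inv_eq_one_div, ← add_div,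
      show 1 + (2 * κ - 1) = 2 * κ by ring, div_self h2κne]
  have hab : (1 / a).HolderConjugate (1 / b) := by
    refine Real.holderConjugate_one_div ha0 hb0 ?_
    rw [ha, hb, ← add_div, show 2 * κ - 2 + 1 = 2 * κ - 1 by ring, div_self hne]
  have h2q : 2 * q = 2 * a + 4 * b := by
    rw [hq, ha, hb, mul_div_assoc', mul_div_assoc', mul_div_assoc', ← add_div]
    congr 1
    ring
  have hq2 : q ≤ 2 := by rw [hq, div_le_iff₀ h2κ1]; linarith
  have h2q4 : 2 * q ≤ 4 := by linarith
  have haq : a / q = 1 - 1 / κ := by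
    rw [ha, hq, div_div_div_cancel_right₀ hne, eq_sub_iff_add_eq, div_add_div _ _ h2κne hκne,
      div_eq_iff (mul_ne_zero h2κne hκne)]
    ring
  have hbq : b / q = 1 / (2 * κ) := by rw [hb, hq, div_div_div_cancel_right₀ hne]
  have hκinv : 1 / κ ≤ 1 / 2 := one_div_le_one_div_of_le (by norm_num) hκ2
  have ha2 : 2 * a * (1 / a) = 2 := by rw [mul_one_div, mul_div_assoc, div_self ha0.ne', mul_one]
  have hb4 : 4 * b * (1 / b) = ((4 : ℕ) : ℝ) := by
    rw [mul_one_div, mul_div_assoc, div_self hb0.ne', mul_one]; norm_num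
  have hp_nat : p = ((2 * k : ℕ) : ℝ) := by rw [hp, hκ]; push_cast; ring
  -- integrability and moment facts
  have hI2 := commonPastBound_fnorm_le hω hl hβ hγ hT N t
  have hI4 := commonPastBound_fcast_fourth_moment hω hl hβ hγ hT N t
  have hvm : Measurable v := commonPastBound_measurable_fcast_right hω hl hβ hγ N t
  have hp0m : Measurable fun z : PhaseSpace (N + 1) => z.2 0 :=
    (measurable_pi_apply 0).comp measurable_snd
  have hIp4 : Integrable (fun z : PhaseSpace (N + 1) => z.2 0 ^ 4) μ₀ :=
    commonPastBound_integrable_momentum_pow_gibbsMeasure hω hl hβ γ hT 0 4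
  have hcm := commonPastBound_integral_centredSq_pow_le hω hl hβ γ hT (0 : Fin (N + 1)) k
  have hT1 : ∫ z : PhaseSpace (N + 1), z.2 0 ^ 2 ∂μ₀ = T := by
    have h := commonPastBound_gibbs_even_moment hω hl hβ γ hT (0 : Fin (N + 1)) 1
    simpa using h
  set S := fnorm ω₂ lam β γ T N t with hS
  have hS' : S = ∫ z, v z ^ 2 ∂μ₀ := rfl
  have hS0 : 0 ≤ S := fnorm_nonneg _ _ _ _ _ N t
  have hST : S ≤ T := hI2.2
  set M := ∫ z, v z ^ 4 ∂μ₀ with hM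
  have hM0 : 0 ≤ M := integral_nonneg fun z => by positivity
  have hM3 : M ≤ 3 * T ^ 2 := hI4.2
  -- Step A: `P = ∫ (p₀² − T) v²`, `|P| ≤ ∫ |p₀² − T| v²`
  have hIf2v2 : Integrable (fun z : PhaseSpace (N + 1) => z.2 0 ^ 2 * v z ^ 2) μ₀ := by
    refine ((hIp4.add hI4.1).div_const 2).mono'
      ((hp0m.pow_const 2).mul (hvm.pow_const 2)).aestronglyMeasurable
      (Eventually.of_forall fun z => ?_)
    rw [Real.norm_of_nonneg (by positivity)]
    simp only [Pi.add_apply]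
    nlinarith [two_mul_le_add_sq (z.2 0 ^ 2) (v z ^ 2)]
  have hPA : commonPast ω₂ lam β γ T N t = ∫ z, (z.2 0 ^ 2 - T) * v z ^ 2 ∂μ₀ := by
    have e : (fun z : PhaseSpace (N + 1) => (z.2 0 ^ 2 - T) * v z ^ 2) =
        fun z => z.2 0 ^ 2 * v z ^ 2 - T * v z ^ 2 := by
      funext z; ring
    show (∫ z, z.2 0 ^ 2 * v z ^ 2 ∂μ₀) - (∫ z, z.2 0 ^ 2 ∂μ₀) * (∫ z, v z ^ 2 ∂μ₀) = _
    rw [hT1, e, integral_sub hIf2v2 (hI2.1.const_mul T), integral_const_mul]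
  set f : PhaseSpace (N + 1) → ℝ := fun z => |z.2 0 ^ 2 - T| with hf
  set g : PhaseSpace (N + 1) → ℝ := fun z => v z ^ 2 with hg
  have hA : |commonPast ω₂ lam β γ T N t| ≤ ∫ z, f z * g z ∂μ₀ := by
    rw [hPA]
    refine abs_integral_le_integral_abs.trans (le_of_eq (integral_congr_ae
      (Eventually.of_forall fun z => ?_)))
    simp only [hf, hg, abs_mul, abs_pow, sq_abs]
  -- Step B: Hölder with exponents `(p, q)`
  have hfm : Measurable f := by
    have h := continuous_abs.measurable.comp ((hp0m.pow_const 2).sub (measurable_const (a := T)))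
    exact h
  have hgm : Measurable g := hvm.pow_const 2
  have hf_mem : MemLp f (ENNReal.ofReal p) μ₀ := by
    refine commonPastBound_memLp_of_integrable_abs_rpow hp0 hfm.aestronglyMeasurable ?_
    have e : (fun z => |f z| ^ p) = fun z : PhaseSpace (N + 1) => |z.2 0 ^ 2 - T| ^ (2 * k) := by
      funext z
      simp only [hf, abs_abs]
      rw [hp_nat, Real.rpow_natCast]
    rw [e]
    exact hcm.1
  have hg_mem : MemLp g (ENNReal.ofReal q) μ₀ := by
    refine commonPastBound_memLp_of_integrable_abs_rpow hq0 hgm.aestronglyMeasurable ?_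
    have h4 : Integrable (fun z => ‖v z‖ ^ (4 : ℝ)) μ₀ := by
      refine hI4.1.congr (Eventually.of_forall fun z => ?_)
      simp only
      rw [Real.norm_eq_abs, show (4 : ℝ) = ((4 : ℕ) : ℝ) by norm_num, Real.rpow_natCast,
        Even.pow_abs (by decide)]
    have h2q' := integrable_norm_rpow_of_le hvm.aestronglyMeasurable
      (by positivity : (0 : ℝ) ≤ 2 * q) (by norm_num) h2q4 h4
    refine h2q'.congr (Eventually.of_forall fun z => ?_)
    simp only [hg]
    rw [Real.norm_eq_abs, Real.rpow_mul (abs_nonneg _), Real.rpow_two, abs_pow]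
  have hB := integral_mul_le_Lp_mul_Lq_of_nonneg hpq (Eventually.of_forall fun z => abs_nonneg _)
    (Eventually.of_forall fun z => sq_nonneg _) hf_mem hg_mem
  have hfp : ∫ z, f z ^ p ∂μ₀ ≤ D := by
    have e : (fun z => f z ^ p) = fun z : PhaseSpace (N + 1) => |z.2 0 ^ 2 - T| ^ (2 * k) := by
      funext z
      simp only [hf]
      rw [hp_nat, Real.rpow_natCast]
    rw [e]
    exact hcm.2
  have hfp0 : 0 ≤ ∫ z, f z ^ p ∂μ₀ :=
    integral_nonneg fun z => Real.rpow_nonneg (abs_nonneg _) _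
  -- Step C: interpolation `∫ (v²)^q ≤ (∫ v²)^a (∫ v⁴)^b` (Hölder with exponents `(1/a, 1/b)`)
  have hC : ∫ z, g z ^ q ∂μ₀ ≤ S ^ a * M ^ b := by
    have e : (fun z => g z ^ q) = fun z => |v z| ^ (2 * a) * |v z| ^ (4 * b) := by
      funext z
      simp only [hg]
      rw [← Real.rpow_add' (abs_nonneg _) (by positivity), ← h2q, Real.rpow_mul (abs_nonneg _),
        Real.rpow_two, sq_abs]
    rw [e]
    have hF_mem : MemLp (fun z => |v z| ^ (2 * a)) (ENNReal.ofReal (1 / a)) μ₀ := by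
      refine commonPastBound_memLp_of_integrable_abs_rpow (by positivity)
        ((continuous_abs.measurable.comp hvm).pow_const _).aestronglyMeasurable ?_
      refine hI2.1.congr (Eventually.of_forall fun z => ?_)
      simp only
      rw [abs_of_nonneg (Real.rpow_nonneg (abs_nonneg _) _), ← Real.rpow_mul (abs_nonneg _),
        ha2, Real.rpow_two, sq_abs]
    have hG_mem : MemLp (fun z => |v z| ^ (4 * b)) (ENNReal.ofReal (1 / b)) μ₀ := by
      refine commonPastBound_memLp_of_integrable_abs_rpow (by positivity)
        ((continuous_abs.measurable.comp hvm).pow_const _).aestronglyMeasurable ?_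
      refine hI4.1.congr (Eventually.of_forall fun z => ?_)
      simp only
      rw [abs_of_nonneg (Real.rpow_nonneg (abs_nonneg _) _), ← Real.rpow_mul (abs_nonneg _),
        hb4, Real.rpow_natCast, Even.pow_abs (by decide)]
    have hH := integral_mul_le_Lp_mul_Lq_of_nonneg hab
      (Eventually.of_forall fun z => Real.rpow_nonneg (abs_nonneg _) _)
      (Eventually.of_forall fun z => Real.rpow_nonneg (abs_nonneg _) _) hF_mem hG_mem
    have e1 : ∫ z, (|v z| ^ (2 * a)) ^ (1 / a) ∂μ₀ = S := by
      rw [hS']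
      refine integral_congr_ae (Eventually.of_forall fun z => ?_)
      simp only
      rw [← Real.rpow_mul (abs_nonneg _), ha2, Real.rpow_two, sq_abs]
    have e2 : ∫ z, (|v z| ^ (4 * b)) ^ (1 / b) ∂μ₀ = M := by
      rw [hM]
      refine integral_congr_ae (Eventually.of_forall fun z => ?_)
      simp only
      rw [← Real.rpow_mul (abs_nonneg _), hb4, Real.rpow_natCast, Even.pow_abs (by decide)]
    rw [e1, e2, one_div_one_div, one_div_one_div] at hH
    exact hH
  -- Step D: assembly
  have hgq0 : 0 ≤ ∫ z, g z ^ q ∂μ₀ := integral_nonneg fun z => Real.rpow_nonneg (sq_nonneg _) _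
  have hD0 : 0 ≤ D := by positivity
  have h1 : (∫ z, f z ^ p ∂μ₀) ^ (1 / p) ≤ D ^ (1 / p) := Real.rpow_le_rpow hfp0 hfp (by positivity)
  have h2 : (∫ z, g z ^ q ∂μ₀) ^ (1 / q) ≤ (S ^ a * (3 * T ^ 2) ^ b) ^ (1 / q) := by
    refine Real.rpow_le_rpow hgq0 (hC.trans ?_) (by positivity)
    exact mul_le_mul_of_nonneg_left (Real.rpow_le_rpow hM0 hM3 hb0.le) (Real.rpow_nonneg hS0 _)
  have h3 : (S ^ a * (3 * T ^ 2) ^ b) ^ (1 / q) = S ^ (a / q) * (3 * T ^ 2) ^ (b / q) := by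
    rw [Real.mul_rpow (Real.rpow_nonneg hS0 _) (Real.rpow_nonneg (by positivity) _),
      ← Real.rpow_mul hS0, ← Real.rpow_mul (by positivity), mul_one_div, mul_one_div]
  have haqθ : 0 ≤ a / q - θ := by rw [haq]; linarith
  have h4 : S ^ (a / q) ≤ T ^ (a / q - θ) * S ^ θ := by
    have hsplit : S ^ (a / q) = S ^ (a / q - θ) * S ^ θ := by
      rw [← Real.rpow_add' hS0 (by rw [sub_add_cancel, haq]; linarith : a / q - θ + θ ≠ 0),
        sub_add_cancel]
    rw [hsplit]
    exact mul_le_mul_of_nonneg_right (Real.rpow_le_rpow hS0 hST haqθ) (Real.rpow_nonneg hS0 _)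
  calc |commonPast ω₂ lam β γ T N t| ≤ ∫ z, f z * g z ∂μ₀ := hA
    _ ≤ (∫ z, f z ^ p ∂μ₀) ^ (1 / p) * (∫ z, g z ^ q ∂μ₀) ^ (1 / q) := hB
    _ ≤ D ^ (1 / p) * (S ^ (a / q) * (3 * T ^ 2) ^ (b / q)) := by
        rw [← h3]
        exact mul_le_mul h1 h2 (Real.rpow_nonneg hgq0 _) (Real.rpow_nonneg hD0 _)
    _ ≤ D ^ (1 / p) * ((T ^ (a / q - θ) * S ^ θ) * (3 * T ^ 2) ^ (b / q)) := by
        gcongr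
    _ = (D ^ (1 / (2 * κ)) * (3 * T ^ 2) ^ (1 / (2 * κ)) * T ^ (1 - 1 / κ - θ)) * S ^ θ := by
        rw [hbq, haq, hp]
        ring

/-- **`∀ θ ∈ (0,1) ∃ K(θ,T) ∀ N t: |P_N(t)| ≤ K·S_N(t)^θ`** (choose an integer `k ≥ 1/(1−θ)` in
`commonPastBound_abs_commonPast_le_of_two_le`; the constant is fixed BEFORE `N`). [folklore] -/
theorem commonPastBound_exists_const {θ : ℝ} (hθ0 : 0 < θ) (hθ1 : θ < 1) :
    ∃ K : ℝ, ∀ (N : ℕ) (t : ℝ), |commonPast ω₂ lam β γ T N t| ≤ K * fnorm ω₂ lam β γ T N t ^ θ := by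
  obtain ⟨k, hk⟩ := exists_nat_ge (1 / (1 - θ))
  have h1θ : 0 < 1 - θ := by linarith
  have hk1 : (1 : ℝ) < k := by
    have : (1 : ℝ) < 1 / (1 - θ) := by rw [lt_div_iff₀ h1θ]; linarith
    linarith
  have hk2 : 2 ≤ k := by
    have := Nat.one_lt_cast.1 hk1
    omega
  have hθk : θ ≤ 1 - 1 / (k : ℝ) := by
    have hk0 : (0 : ℝ) < k := by linarith
    rw [div_le_iff₀ h1θ] at hk
    rw [le_sub_comm, div_le_iff₀ hk0]
    linarith
  exact ⟨_, fun N t => commonPastBound_abs_commonPast_le_of_two_le hω hl hβ hγ hT hk2 hθk N t⟩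

end Holder

/-! ### The registered stub -/

/-- **Stub `stub_commonPastBound`** of the line `two-horizons-forecast-loss` (crux
`PhononMeanFreePath.IncoherentChannel`): for the pinned anharmonic chain with both baths at `T > 0`,
(i) `t ↦ P_N(t) = Cov_{μ_T}(p_0², v_t²)` and `t ↦ r_N(t) = ⟨p_0, v_t⟩_{μ_T}` are measurable;
(ii) `r_N(t)² ≤ T·S_N(t)` (Cauchy–Schwarz, `‖p_0‖² = T`); (iii) for every `θ ∈ (0,1)` an
`N`-INDEPENDENT `K = K(θ,T)` with `|P_N(t)| ≤ K·S_N(t)^θ` for all `N`, `t ≥ 0` (Hölder against the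
Gaussian moments of `p_0² − T` and `L²–L⁴` interpolation of `v_t`, using the Gibbs invariance of the
constructed kernels `K_t`). Here `v_t = K_t p_N` (`fcast`) and `S_N = ‖v_t‖²_{L²(μ_T)}` (`fnorm`).
[folklore] -/
theorem stub_commonPastBound : ∀ ω₂ lam β γ : ℝ, 0 < ω₂ → 0 < lam → 0 < β → 0 < γ → ∀ T : ℝ, 0 < T → (∀ N : ℕ, Measurable (commonPast ω₂ lam β γ T N) ∧ Measurable (pairCorr ω₂ lam β γ T N)) ∧ (∀ (N : ℕ) (t : ℝ), 0 ≤ t → (pairCorr ω₂ lam β γ T N t) ^ 2 ≤ T * fnorm ω₂ lam β γ T N t) ∧ ∀ θ : ℝ, 0 < θ → θ < 1 → ∃ K : ℝ, ∀ (N : ℕ) (t : ℝ), 0 ≤ t → |commonPast ω₂ lam β γ T N t| ≤ K * (fnorm ω₂ lam β γ T N t) ^ θ := by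
  intro ω₂ lam β γ hω hl hβ hγ T hT
  refine ⟨fun N => ⟨commonPastBound_measurable_commonPast hω hl.le hβ.le hγ.le hT N,
      commonPastBound_measurable_pairCorr hω hl.le hβ.le hγ.le hT N⟩,
    fun N t _ => commonPastBound_pairCorr_sq_le hω hl.le hβ.le hγ.le hT N t, fun θ hθ0 hθ1 => ?_⟩
  obtain ⟨K, hK⟩ := commonPastBound_exists_const hω hl.le hβ.le hγ.le hT hθ0 hθ1
  exact ⟨K, fun N t _ => hK N t⟩

end Summit.AtomisticToContinuum.FouriersLaw.Theorems.PhononMeanFreePath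

end
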